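import Summits.BirchSwinnertonDyer.BirchSwinnertonDyer.Theorems.PrintX11aNonSurjEulerHalfOfMu
import Summits.BirchSwinnertonDyer.BirchSwinnertonDyer.Theorems.PrintX11aNonSurjMuAnHardDefs
import Summits.BirchSwinnertonDyer.BirchSwinnertonDyer.Theorems.PrintX11aUpperNonSurjThreeMultDivisibilityAtOfConjA
import Summits.BirchSwinnertonDyer.BirchSwinnertonDyer.Theorems.SignedBaseChangeCanonicalGeneratorPair
import Literature.NumberTheory.EllipticCurves.Rank1Residual.MuLambdaCarriers
import Literature.NumberTheory.EllipticCurves.TwoVariableSelmerDual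
import Literature.NumberTheory.EllipticCurves.HeegnerPoints
import Literature.NumberTheory.EllipticCurves.BSDQuadraticDescent
import HarnessLib

/-!
# Line «cartan5» rev 2 (DECOMPOSED) for the child crux U5 = `PrintX11a.UpperNonSurjFive`
# (item stmt-BirchSwinnertonDyer-20614) of route `route-BirchSwinnertonDyer-PrintX11a` — ideator seat bsd-idea-6
# (lens «decomp»), generation g3, 2026-08-28.  PUBLISHED, not registered (W-79: the line of record «finemu5» of the
# lead x11a-p3 keeps the skeleton check); BSD is not proved by any of this; nothing is asserted about any curve.

**Rev 2.1 (2026-08-28 08:4xZ, answering critic VERDICT #13-rev2):** P3′ — S5's conclusion gains the typed conjunct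
(iii) `∀ x : X^ord₂, (C X) • x = 0 → x = 0` (no `(γ₂ − 1)`-torsion), consumed by S6b's specialisation step, so the
«`X₂[γ₂ − 1]` controlled» input is a NAMED HYPOTHESIS and no longer prose; P2′ — the one-variable ⇒ two-variable lifting lemma is
displayed in the plan memo (§H5′) and S5's docstring; S5 additionally restricted to NON-split multiplicative `p` (the case the
composition uses); stub count, compositions and every other signature unchanged.

REV 2 = the critic's price on rev 1 (idea-crit-10 V#13, PASS-WITH-PRICE) paid in the currency of the lens:
* (P1) the Cartan road's dependence on the route's OWN lower-half crux `PrintX11a.X11aLowerHalf` (item 19064, shared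
  with K2) is now BY NAME: `stub_x11aLowerHalf : Theses.PrintX11a.X11aLowerHalf` is a registered stub of this file, the
  Cartan-definite datum no longer carries `MissingLowerBoundAt Wd p`, and the μ-road's restricted input `stub 7′` has an
  ARITHMETIC locus (split at `p` ∨ no imaginary quadratic `K` with `p` split over which `ρ̄` is reducible and whose
  twist lies in X11a) — so the ledger reads «S5 + S6a + S6b + S6c + S7′ + 19064 ⇒ U5», which is what the road is;
* (P2) the monolithic beyond-print stub 6 of rev 1 (`μ_Gr = 0 ⇒ joint bound`) is SPLIT into three typed sub-stubs over
  carriers the tree HAS, with the composition `jointUpper_of_parts` PROVED here: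
  S6a `stub_twoVarOrdDivisibility_cartanFive` (XL, the research content, beyond print: a RATIONAL two-variable
  main-conjecture divisibility for `X^ord(E/K̃_∞)` (tree carrier `WeierstrassCurve.XOrd₂`, its `charIdeal` in
  `Λ₂ = IwasawaAlgebra₂ p = ℤ_p⟦T₂⟧⟦T₁⟧`) by SOME `𝓛 ∈ Λ₂` whose restriction to the cyclotomic line `T₂ = 0`
  (`PowerSeries.map constantCoeff`, `T₁ ↔ γ₁ − 1` with `γ₁` CANONICAL, the K1′/K2R‴ clause of route SignedBaseChange,
  free by `Theorems.SignedBaseChangeCanonicalGeneratorPair.exists_isTopGeneratorPair_canonical`) is, up to a unit of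
  `Λ`, the product `ϖL_p(E)·ϖ_dL_p(E^K)` of the two Mazur–Tate–Teitelbaum functions in the route's own one-variable
  currency `IsMultPAdicLFunctionOf f p (-1) L` (both curves NON-split multiplicative at `p`: `E^K ≅ E` over `ℚ_p`);
  S6b `stub_cycProductDivisibility_of_muOrd_cartanFive` (M/L, staffable: `μ(X^ord₂) = 0` + S6a ⇒ by Gauss' lemma in
  the UFD `Λ₂` the divisibility is INTEGRAL, then specialisation to the cyclotomic line (Skinner–Urban 2014 Cor. 3.8-type
  control of `X₂/(γ₂ − 1) → X^ord(E/K^cyc_∞)`, Greenberg's local control at the two non-split multiplicative places)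
  and Shapiro `X(E/K^cyc_∞) ≅ X(E/ℚ_∞) ⊕ X(E^K/ℚ_∞)` give the PRODUCT divisibility
  `(char X(E)·char X(E^K)) ∋ g ↦ ϖϖ_d·L_p(E)L_p(E^K)` in the currency of `X11b.MultDivisibilityAt`);
  S6c `stub_jointUpper_of_cycProductDivisibility_five` (M, staffable: the route's landed single-curve door
  `X11b.missingUpperBoundAt_of_classX11a_of_multDivisibilityAt` re-run for a PRODUCT at `T = 0` — `char X(E) = (f_E)`,
  `char X(E^K) = (f_{E^K})` principal, `ord_p f_E(0) + ord_p f_{E^K}(0) ≤ ord_p(ϖϖ_d L_p(E)(0) L_p(E^K)(0))`, Jones /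
  Greenberg Euler characteristics at a non-split multiplicative prime (no 𝓛-invariant), `L_p(E,𝟙) = 2·L(E,1)/Ω_E`);
* the μ-input is RE-TARGETED to the module S6b consumes: S5 `stub_muOrd_eq_zero_of_reducible` — the ORDINARY
  two-variable dual `X^ord(E/K̃_∞)` (tree `XOrd₂` = dual of the classical Selmer group over the `ℤ_p²`-tower, defined at
  every `p`) is `Λ₂`-torsion with `μ = 0` when `E[p]` is irreducible over `ℚ`, REDUCIBLE over the imaginary quadratic `K`
  (`p` split) and `p` is MULTIPLICATIVE: over `K`, `E[p] = 𝔽(χ) ⊕ 𝔽(χᶜ)` (Clifford; `χ ≠ χᶜ` by irreducibility over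
  `ℚ`), the Tate line at `v` is one of the two eigenlines (they are distinct `D_v`-characters: `χ_cyc·δ` ramified of
  order `p − 1 ≥ 4` vs `δ` unramified) and the Tate line at `v̄ = c·v` is the OTHER one, so the Selmer sandwich
  `Sel(𝔽(χ)) → Sel(E[p]) → Sel(𝔽(χᶜ))` has BOTH outer terms «relaxed at exactly one prime above `p`, strict at the
  other, unramified elsewhere» = the `χ`-parts of `X_{v}(L K̃_∞)/p`, `X_{v̄}(L K̃_∞)/p` for `L = K(χ)` ABELIAN over `K`
  — `ℤ_p`-finitely generated by Gillard (`p ≥ 5`) / Oukhaba–Viguié 2016 Thm. 1.2 (all `p`) and torsion by Greenberg,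
  local error terms at `ℓ ∤ p` PSEUDO-NULL over `Λ₂` (every `ℓ ≠ p` splits into a `ℤ_p`'s worth of primes in `K̃_∞`),
  `E(K̃_∞)[p] = 0`; same proof template, same sources as rev-1 S5 (whose Greenberg-module version stays valid).
Stubs (7 `sorry`s): S3 `stub_pubFactsAn` (K2's item 19949 BY NAME, as on the line of record), S5, S6a, S6b, S6c, S7′
`stub_muAnHard_offCartanFive`, L `stub_x11aLowerHalf` (= route crux 19064 BY NAME); the landed transfer (A) ⇒
`MultDivisibilityAt` is used through `multDivisibilityAt_of_katoFacts_of_muAn` (tree).  Compositions (real proofs): `jointUpper_of_parts`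
(S6a → S6b → S6c ⇒ rev-1 stub 6 without its μ-hypothesis restated: S5 is fed in), `UpperNonSurjFive_of_cartan` (the
crux BY NAME).  The (A)-road / μ-road copies of rev 1 are NOT repeated (they live on the registered line of record
«finemu5»; this file is published-only, W-79).

References: [OukhabaViguie2016] Thm. 1.1–1.2 (arXiv:1311.3565 pp. 1–2); [deShalit1987] III.2.12;
[BurungaleCastellaSkinner2025] §1.4, Conj. 4.1.1/4.1.2, Thm. 4.1.3 (arXiv:2405.00270v2 pp. 4, 8);
[CastellaGrossiSkinner2025] Thm. A (the ℚ-Eisenstein good-reduction prototype of «ES + μ_alg = 0 ⇒ integral MC»);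
[SkinnerUrban2014] §3.1–3.2 (two-variable algebra, Cor. 3.8), §3.4.5 / §12.3 (`𝓛_p(f/K)` on the cyclotomic line =
`L_p(f)L_p(f ⊗ ε_K)`); [Skinner2016PacificMC] §2–3 (the p-new specialisation over `K`); [LeiLoefflerZerbes2015],
[KingsLoefflerZerbes2017] (Beilinson–Flach over `K`; reciprocity stated at levels prime to `p` — the gap);
[Rubin2000EulerSystems] Thm. 2.3.3; [GreenbergLNM1716] §3–4; [Jones1989], [Kato2004Asterisque] §17.13;
[DokchitserDokchitserAnnals2010] §4.4; [MazurTateTeitelbaum1986Invent] §I.13 (canonical variable).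
-/

set_option linter.dupNamespace false
set_option autoImplicit false

noncomputable section

open scoped Classical NumberField MatrixGroups ModularForm

open CongruenceSubgroup WeierstrassCurve Field IsDedekindDomain
  Literature.NumberTheory.GaloisRepresentations
  Literature.NumberTheory.EllipticCurves
  Literature.NumberTheory.EllipticCurves.ModularForms
  Literature.NumberTheory.EllipticCurves.Rank1Residual
  Literature.NumberTheory.EllipticCurves.Rank1Residual.Typed
  Literature.NumberTheory.EllipticCurves.Wuthrich2014
  Literature.NumberTheory.EllipticCurves.SteinWuthrich2013
  Literature.NumberTheory.EllipticCurves.Greenberg1999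
  Literature.NumberTheory.EllipticCurves.Kato2004
  Summit.BirchSwinnertonDyer.Rank1Residual
  Summit.BirchSwinnertonDyer.Rank1Residual.X11b
  Summit.BirchSwinnertonDyer.BirchSwinnertonDyer

namespace Summit.BirchSwinnertonDyer.BirchSwinnertonDyer.Cruxes.UpperNonSurjFive.Cartan

/-! ## The by-name stubs shared with the line of record (S3) and with the route (L = crux 19064) -/

/-- **stub S3 (published inputs, shared with «finemu5»)**: K2's item 19949 BY NAME — the conjunction of the named
published facts (GZK, modularity, parametrisation, Stein–Wuthrich 6.1 split/non-split, Greenberg–Stevens, Kato 12.4 and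
the multiplicative §17.13 inputs, Greenberg 1999 Thm. 1.5, Wuthrich 2014 Cor. 18, Kato fine inputs, …).
[cite: Kato2004Asterisque, Thm. 12.4 (p. 221)] [cite: SteinWuthrich2013, Thm. 6.1 (p. 20)] -/
theorem stub_pubFactsAn : Theses.ErratumRoadFive.KatoTwinFactsFiveAn := by
  sorry

/-- **stub L (the route's OWN lower-half crux BY NAME — item stmt-BirchSwinnertonDyer-19064 `PrintX11a.X11aLowerHalf`,
shared with K2/ErratumRoadFive; rev-2 price P1)**: `ord_p #Ш_an(E_d) ≤ ord_p #Ш(E_d)` at every X11a pair.  Not a target of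
THIS line (K2's Heegner/Kolyvagin skeleton on 19064 owns it); it closes by name when 19064 lands; the Cartan road consumes
it only at the twin `(E^K, p)`.
[cite: Kato2004Asterisque, §17.13 (pp. 279–280)] [cite: SkinnerUrban2014, Thm. 3.29 and §3.6 (the lower-bound template)] -/
theorem stub_x11aLowerHalf : Theses.PrintX11a.X11aLowerHalf := by
  sorry

/-! ## S5 — the THEOREM-grade μ-input, re-targeted to the ordinary two-variable module -/

/-- **stub S5 (NEW TARGET of rev 2; provable from print; `p`-generic — one proof serves «cartan3» and «cartan5»)**: for `K`
imaginary quadratic with `p = v v̄` split (`p` odd), and `E/ℚ` MULTIPLICATIVE at `p` with `E[p]` irreducible over `ℚ`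
but REDUCIBLE over `K` (the Cartan/dihedral case `E[p] ≅ Ind_K^ℚ χ`), the Pontryagin dual `X^ord(E/K̃_∞)` of the
classical Selmer group over the `ℤ_p²`-tower (tree carrier `XOrd₂`, a `Λ₂ = ℤ_p⟦T₂⟧⟦T₁⟧`-module through any generator
pair) is finitely generated TORSION with characteristic ideal NOT contained in `(p)` («torsion with `μ = 0`»).  Proof
sketch (all printed): `E[p]|_{G_K} = 𝔽(χ) ⊕ 𝔽(χᶜ)`, `χ ≠ χᶜ`; the Tate line at `v` is an eigenline (the two
characters differ on `D_v`: `χ_cyc δ` vs `δ`) and the one at `v̄ = cv` is the other; hence in the sandwich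
`H¹_Sel(𝔽(χ)) → Sel(K̃_∞, E[p]) → H¹_Sel(𝔽(χᶜ))` each outer Selmer condition is «no condition at one prime above `p`,
trivial at the other, unramified elsewhere», i.e. a `χ^{±}`-part of `X_{v}(L K̃_∞)/p` or `X_{v̄}(L K̃_∞)/p` for the ABELIAN
extension `L = K(χ)` of `K` — of finite `𝔽_p⟦Γ_K⟧`-corank-zero type by Greenberg (torsion) + Gillard / Oukhaba–Viguié Thm.
1.2 (`μ = 0` for the split-prime `ℤ_p`-tower of an abelian extension of `K`) and Cayley–Hamilton in the second variable;
local terms at `ℓ ∤ p` are pseudo-null over `Λ₂`; `E(K̃_∞)[p] = 0`; `Sel[p]` vs `Sel(E[p])` controlled; so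
`X^ord/p` is `𝔽_p⟦Γ_K⟧`-torsion ⇒ torsion with `μ = 0`.  Rev 2.1 also RESTRICTS S5 to NON-split multiplicative `p`
(`¬ HasSplitMultiplicativeReductionAtPrime`; the only case `jointUpper_of_parts` uses — the split case runs on the Greenberg–Stevens unit road — and the
case free of trivial-zero phenomena, which would make (iii) and the no-pseudo-null input delicate).  Conjunct (iii) (rev 2.1, critic V#13-rev2 price P3′ — the input of S6b's
specialisation step, now TYPED instead of prose): `X^ord₂` has NO `(γ₂ − 1)`-torsion (`T₂ = C X ↔ γ₂ − 1`, the
anticyclotomic variable; `TwoVariableSelmerDual.XOrd₂.CX_smul_apply`), i.e. `X₂[T₂] = 0`: from «no non-zero pseudo-null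
`Λ₂`-submodule» (Greenberg 2016 Prop. 4.1.1 — its hypotheses at a multiplicative `p` with `E(K)[p] = 0` are to be CHECKED by
the prover; flagged) and `T₂ ∤ char_{Λ₂} X₂` (⇐ `X₂/T₂X₂ ↠ X^ord(E/K^cyc_∞)` torsion ⇐ Kato's cyclotomic torsion for `E`, `E^K`
over `ℚ`, item 19949's Thm. 17.4 entry, + Shapiro); a LIFTING LEMMA «one-variable `μ = 0` along the `v`-ramified tower of
`L = K(χ)` (OV16 Thm. 1.2) ⇒ `X_v(LK̃_∞)` finitely generated over `ℤ_p⟦Gal(LK̃_∞/LK_∞^{(v)})⟧` (topological Nakayama through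
the control surjection)» settles WHICH tower's `μ` is used (never the cyclotomic one) — plan `Lines/cartan5-S5plan.md` §H5′/H6.  Rev-1's Greenberg-module statement `stub_muGr_eq_zero_of_reducible`
is the same theorem for `XGr₂` and stays valid; S6b consumes THIS one.
[cite: OukhabaViguie2016, Thm. 1.1 (Gillard, Schneps) and Thm. 1.2 (arXiv:1311.3565 pp. 1–2)]
[cite: deShalit1987, III.2.12 Theorem ([Gi2] 2.9) and Corollary (p. 103)]
[cite: BurungaleCastellaSkinner2025, §1.4 (p. 4 of arXiv:2405.00270v2) (the module `X^ord(E/K_∞)`)] -/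
theorem stub_muOrd_eq_zero_of_reducible :
    ∀ (W : WeierstrassCurve ℚ) [W.IsElliptic] [W.IsGloballyMinimal] (p : ℕ) [Fact p.Prime]
      (K : Type) [Field K] [NumberField K]
      (κ₁ κ₂ : ZpExtension K p) (γ₁ γ₂ : Field.absoluteGaloisGroup K)
      [Fact (ZpExtension.IsTopGeneratorPair κ₁ κ₂ γ₁ γ₂)],
      p ≠ 2 → IsImaginaryQuadratic K → ((Ideal.span {(p : ℤ)}).primesOver (𝓞 K)).ncard = 2 →
      Mult W p → Irr W p → ¬ (W.baseChange K).HasIrreducibleModPGaloisRep p →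
      ¬ W.HasSplitMultiplicativeReductionAtPrime p →
      Module.Finite (IwasawaAlgebra₂ p) ((W.baseChange K).XOrd₂ p κ₁ κ₂ γ₁ γ₂) ∧
        Module.IsTorsion (IwasawaAlgebra₂ p) ((W.baseChange K).XOrd₂ p κ₁ κ₂ γ₁ γ₂) ∧
        ¬ (WeierstrassCurve.XOrd₂.charIdeal (W.baseChange K) p κ₁ κ₂ γ₁ γ₂ ≤
            Ideal.span {(p : IwasawaAlgebra₂ p)}) ∧
        (∀ x : (W.baseChange K).XOrd₂ p κ₁ κ₂ γ₁ γ₂,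
          (PowerSeries.C (PowerSeries.X : IwasawaAlgebra p) : IwasawaAlgebra₂ p) • x = 0 → x = 0) := by
  sorry

/-! ## S6a / S6b / S6c — the typed split of rev-1 stub 6, and its proved composition -/

/-- **stub S6a (XL, LOAD-BEARING, beyond print — the research content of the road, now ISOLATED)**: on the Cartan-definite
sub-locus (X11a pair, `ρ̄` not surjective, `p ≥ 5`, `K` imaginary quadratic with `p` split over which `ρ̄` is reducible,
`E` NON-split multiplicative at `p`, `Wd` a minimal model of `E^K`), for the (cyclotomic, anticyclotomic) tower of `K` with
an adapted generator pair whose cyclotomic generator `γ₁` is CANONICAL (`χ_cyc,K(γ₁) ∈ (1+p)·μ`), there is `𝓛 ∈ Λ₂` with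
(i) the RATIONAL two-variable ordinary divisibility `p^t·𝓛 ∈ char_{Λ₂} X^ord(E/K̃_∞)` for some `t`, and (ii) on the
cyclotomic line `T₂ = 0` (`T₁ ↔ γ₁ − 1 ↔ γ − 1` for every canonical `ℚ`-datum `(κ, γ)`), up to a unit of `Λ`,
`𝓛|_{cyc} = ϖL_p(E) · ϖ_dL_p(E^K)` for the Mazur–Tate–Teitelbaum functions of the newforms of `E`, `E^K` (`a_p = −1` for
both: `E^K ≅ E` over `ℚ_p`) and the plus-period scalars `ϖ, ϖ_d`.  Intended: `𝓛` = the Hida–Rankin two-variable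
function of `f_E/K` specialised at the `p`-NEW weight-2 point of the Hida family (Skinner 2016 §2–3), divisibility from the
Beilinson–Flach Euler system over `K` (LLZ15/KLZ17; Rubin Thm. 2.3.3 needs Hyp(K_∞, V) only — `V_pE|_{G_K}` irreducible
with a unipotent, true for non-CM `E` — not residual irreducibility) transported to the ordinary side (BCS Thm. 4.1.3 /
Yan–Zhu Thm. 4.7 shape), and the factorisation `𝓛_p(f/K)|_{cyc} ≐ L_p(f)L_p(f ⊗ ε_K)` with Hida's canonical period `≐
Ω_E^+Ω_{E^K}^+` up to a `p`-unit (Gorenstein at an irreducible `p`-distinguished `ρ̄`; `(d_K, p) = 1`; Ribet–Takahashi /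
Agashe–Ribet–Stein at `p ∥ N`).  NOT in print: the explicit reciprocity law and the interpolation at a `p`-new point (KLZ17
is prime-to-`p` level), cf. barrier note `ReducibleAnticyclotomicAtBadP`.  Why it might fail: the `p`-new reciprocity law
may carry a non-unit 𝓛-invariant-type factor even in the non-split case, or the period ratio may not be a `p`-unit at a
Cartan image (congruences with CM-type forms over `K`).
[cite: SkinnerUrban2014, §3.4.5 and §12.3 (cyclotomic restriction of `𝓛_p(f/K)`)] [cite: Skinner2016PacificMC, §2.2–§3.1 (the p-new specialisation)]
[cite: KingsLoefflerZerbes2017, Thm. B / §10 (explicit reciprocity law, level prime to p) (arXiv:1503.02888 p. 11, p. 90)]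
[cite: BurungaleCastellaSkinner2025, Thm. 4.1.3 (arXiv:2405.00270v2 p. 8)] [cite: MazurTateTeitelbaum1986Invent, §I.13] -/
theorem stub_twoVarOrdDivisibility_cartanFive :
    ∀ (W : WeierstrassCurve ℚ) [W.IsElliptic] [W.IsGloballyMinimal] (p : ℕ) [Fact p.Prime]
      (K : Type) [Field K] [NumberField K]
      (Wd : WeierstrassCurve ℚ) [Wd.IsElliptic] [Wd.IsGloballyMinimal]
      (κ₁ κ₂ : ZpExtension K p) (γ₁ γ₂ : Field.absoluteGaloisGroup K)
      [Fact (ZpExtension.IsTopGeneratorPair κ₁ κ₂ γ₁ γ₂)],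
      ClassX11a W p → ¬ Surj W p → 5 ≤ p →
      IsImaginaryQuadratic K → ((Ideal.span {(p : ℤ)}).primesOver (𝓞 K)).ncard = 2 →
      (∃ C : VariableChange ℚ, C • W.quadraticTwist (NumberField.discr K : ℚ) = Wd) →
      ¬ (W.baseChange K).HasIrreducibleModPGaloisRep p →
      ¬ W.HasSplitMultiplicativeReductionAtPrime p →
      κ₁.IsCyclotomic → κ₂.IsAnticyclotomic →
      (∃ ζ : ℤ_[p]ˣ, IsOfFinOrder ζ ∧
        ((GaloisRep.cyclotomicCharacter K p γ₁ * ζ : ℤ_[p]ˣ) : ℤ_[p]) = (cyclotomicGenerator p : ℤ_[p])) →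
      ∃ 𝓛 : IwasawaAlgebra₂ p,
        (∃ t : ℕ, (p : IwasawaAlgebra₂ p) ^ t * 𝓛 ∈
          WeierstrassCurve.XOrd₂.charIdeal (W.baseChange K) p κ₁ κ₂ γ₁ γ₂) ∧
        ∀ {κ : ZpExtension ℚ p} {γ : Field.absoluteGaloisGroup ℚ} {N Nd : ℕ} [NeZero N] [NeZero Nd]
          {f : CuspForm (Gamma0 N) 2} {fd : CuspForm (Gamma0 Nd) 2},
          κ.IsCyclotomic → κ.IsTopGenerator γ → IsCyclotomicVariable p γ →
          IsNewformOf W f → IsNewformOf Wd fd →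
          ∀ (ϖ ϖd : ℚ), (ϖ : ℝ) * W.realPeriodRat = plusPeriod f → (ϖd : ℝ) * Wd.realPeriodRat = plusPeriod fd →
          ∀ (L Ld : PowerSeries ℚ_[p]), IsMultPAdicLFunctionOf f p (-1) L → IsMultPAdicLFunctionOf fd p (-1) Ld →
          ∃ u : (IwasawaAlgebra p)ˣ,
            iwasawaToPowerSeries p ((u : IwasawaAlgebra p) * PowerSeries.map (PowerSeries.constantCoeff (R := ℤ_[p])) 𝓛) =
              PowerSeries.C (((ϖ * ϖd : ℚ)) : ℚ_[p]) * (L * Ld) := by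
  sorry

/-- **stub S6b (M/L, STAFFABLE once S6a is granted as a hypothesis — pure two-variable Iwasawa algebra + control)**: at the
same data, «`X^ord(E/K̃_∞)` torsion with `μ = 0`» (S5) and the rational divisibility-with-factorisation package of S6a give
the INTEGRAL cyclotomic PRODUCT divisibility for the twist pair `(E, E^K)` in the currency of `X11b.MultDivisibilityAt`:
for every canonical `ℚ`-cyclotomic datum and newforms/periods/MTT functions of the two curves, `X(E/ℚ_∞)` and
`X(E^K/ℚ_∞)` are `Λ`-torsion and some `g ∈ char X(E)·char X(E^K)` maps to `ϖϖ_d · L_p(E)L_p(E^K)`.  Intended proof: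
Gauss' lemma in the UFD `Λ₂` (`p` prime in `Λ₂`, `p ∤ char`, `p^t𝓛 ∈ (char)` ⇒ `𝓛 ∈ (char)`); specialisation
`π : Λ₂ → Λ`, `T₂ ↦ 0`: `π(char_{Λ₂} X₂) ⊆ char_Λ(X₂/(γ₂−1)X₂)·(correction from X₂[γ₂−1])` (Skinner–Urban Cor. 3.8 shape;
no-pseudo-null input from Greenberg 2016 if needed) and control `X₂/(γ₂ − 1) → X(E/K^cyc_∞)` (restriction/corestriction
in the anticyclotomic direction; Greenberg's local control at the two NON-split multiplicative places `v, v̄` and at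
`ℓ ∣ N d_K`); Shapiro `X(E/K^cyc_∞) ≅ X(E/ℚ_∞) ⊕ X(E^K/ℚ_∞)` for `p` odd split in `K` (the cyclotomic variable of `K`
matches the canonical `ℚ`-variable: `Theorems.SignedBaseChangeCanonicalGeneratorPair.exists_isCyclotomicVariable_matching_iff_canonical`),
`char(A ⊕ B) = char A · char B`; the unit `u` is absorbed into `g`.  Rev 2.1 (critic P3′): the specialisation input
`X₂[γ₂ − 1] = 0` is now the TYPED conjunct (iii) of the S5 package (a hypothesis here, no longer prose); with it the tree's
Herbrand specialisation formula `PowerSeriesSpecialization.charIdeal_quotSMulTop_eq_mul` (`ch(N/XN) = ch(N[X])·ch(N)(0)`, after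
the swap of the two variables) gives `π(char_{Λ₂} X₂) = char_Λ(X₂/T₂X₂)`, and `IwasawaTheory.uniqueFactorizationMonoid_powerSeries_powerSeries`
is the factoriality Gauss' lemma needs.  Why it might fail: the control surjection `X₂/T₂X₂ ↠ X^ord(E/K^cyc_∞)` is exact only up
to the local terms at `v, v̄` (non-split multiplicative: `H⁰`-terms of the Tate twist, finite and `Λ`-pseudo-null as needed) and at
`ℓ ∣ N d_K` — bookkeeping, but owed in Lean.
[cite: SkinnerUrban2014, §3.1.7–3.1.8, Cor. 3.8 (two-variable specialisation of characteristic ideals)]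
[cite: GreenbergLNM1716, §3 Prop. 3.7–3.9 and §4 (control at multiplicative primes)] [cite: Greenberg2016, Prop. 4.1.1 (no pseudo-null submodules)] -/
theorem stub_cycProductDivisibility_of_muOrd_cartanFive :
    ∀ (W : WeierstrassCurve ℚ) [W.IsElliptic] [W.IsGloballyMinimal] (p : ℕ) [Fact p.Prime]
      (K : Type) [Field K] [NumberField K]
      (Wd : WeierstrassCurve ℚ) [Wd.IsElliptic] [Wd.IsGloballyMinimal]
      (κ₁ κ₂ : ZpExtension K p) (γ₁ γ₂ : Field.absoluteGaloisGroup K)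
      [Fact (ZpExtension.IsTopGeneratorPair κ₁ κ₂ γ₁ γ₂)],
      ClassX11a W p → ¬ Surj W p → 5 ≤ p →
      IsImaginaryQuadratic K → ((Ideal.span {(p : ℤ)}).primesOver (𝓞 K)).ncard = 2 →
      (∃ C : VariableChange ℚ, C • W.quadraticTwist (NumberField.discr K : ℚ) = Wd) →
      ¬ (W.baseChange K).HasIrreducibleModPGaloisRep p →
      ¬ W.HasSplitMultiplicativeReductionAtPrime p →
      κ₁.IsCyclotomic → κ₂.IsAnticyclotomic →
      (∃ ζ : ℤ_[p]ˣ, IsOfFinOrder ζ ∧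
        ((GaloisRep.cyclotomicCharacter K p γ₁ * ζ : ℤ_[p]ˣ) : ℤ_[p]) = (cyclotomicGenerator p : ℤ_[p])) →
      -- S5 at these data
      (Module.Finite (IwasawaAlgebra₂ p) ((W.baseChange K).XOrd₂ p κ₁ κ₂ γ₁ γ₂) ∧
        Module.IsTorsion (IwasawaAlgebra₂ p) ((W.baseChange K).XOrd₂ p κ₁ κ₂ γ₁ γ₂) ∧
        ¬ (WeierstrassCurve.XOrd₂.charIdeal (W.baseChange K) p κ₁ κ₂ γ₁ γ₂ ≤
            Ideal.span {(p : IwasawaAlgebra₂ p)}) ∧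
        (∀ x : (W.baseChange K).XOrd₂ p κ₁ κ₂ γ₁ γ₂,
          (PowerSeries.C (PowerSeries.X : IwasawaAlgebra p) : IwasawaAlgebra₂ p) • x = 0 → x = 0)) →
      -- S6a at these data
      (∃ 𝓛 : IwasawaAlgebra₂ p,
        (∃ t : ℕ, (p : IwasawaAlgebra₂ p) ^ t * 𝓛 ∈
          WeierstrassCurve.XOrd₂.charIdeal (W.baseChange K) p κ₁ κ₂ γ₁ γ₂) ∧
        ∀ {κ : ZpExtension ℚ p} {γ : Field.absoluteGaloisGroup ℚ} {N Nd : ℕ} [NeZero N] [NeZero Nd]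
          {f : CuspForm (Gamma0 N) 2} {fd : CuspForm (Gamma0 Nd) 2},
          κ.IsCyclotomic → κ.IsTopGenerator γ → IsCyclotomicVariable p γ →
          IsNewformOf W f → IsNewformOf Wd fd →
          ∀ (ϖ ϖd : ℚ), (ϖ : ℝ) * W.realPeriodRat = plusPeriod f → (ϖd : ℝ) * Wd.realPeriodRat = plusPeriod fd →
          ∀ (L Ld : PowerSeries ℚ_[p]), IsMultPAdicLFunctionOf f p (-1) L → IsMultPAdicLFunctionOf fd p (-1) Ld →
          ∃ u : (IwasawaAlgebra p)ˣ,
            iwasawaToPowerSeries p ((u : IwasawaAlgebra p) * PowerSeries.map (PowerSeries.constantCoeff (R := ℤ_[p])) 𝓛) =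
              PowerSeries.C (((ϖ * ϖd : ℚ)) : ℚ_[p]) * (L * Ld)) →
      -- the integral cyclotomic PRODUCT divisibility for (E, E^K)
      ∀ {κ : ZpExtension ℚ p} {γ : Field.absoluteGaloisGroup ℚ} {N Nd : ℕ} [NeZero N] [NeZero Nd]
        {f : CuspForm (Gamma0 N) 2} {fd : CuspForm (Gamma0 Nd) 2},
        κ.IsCyclotomic → κ.IsTopGenerator γ → IsCyclotomicVariable p γ →
        IsNewformOf W f → IsNewformOf Wd fd →
        ∀ (D : W.SelmerDualData κ γ) (Dd : Wd.SelmerDualData κ γ) (ϖ ϖd : ℚ), ϖ ≠ 0 → ϖd ≠ 0 →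
          (ϖ : ℝ) * W.realPeriodRat = plusPeriod f → (ϖd : ℝ) * Wd.realPeriodRat = plusPeriod fd →
          ∀ (L Ld : PowerSeries ℚ_[p]), IsMultPAdicLFunctionOf f p (-1) L → IsMultPAdicLFunctionOf fd p (-1) Ld →
            D.IsTorsion ∧ Dd.IsTorsion ∧
              ∃ g ∈ D.charIdeal * Dd.charIdeal,
                iwasawaToPowerSeries p g = PowerSeries.C (((ϖ * ϖd : ℚ)) : ℚ_[p]) * (L * Ld) := by
  sorry

/-- **stub S6c (M, STAFFABLE — the route's landed single-curve door re-run for a product at `T = 0`)**: for two X11a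
pairs `(E, p)`, `(E_d, p)` with `p ≥ 5`, `E` NON-split multiplicative at `p`, `E_d` a minimal model of the twist of `E` by the
discriminant of an imaginary quadratic `K` in which `p` splits (so `E_d ≅ E` over `ℚ_p`: non-split, `a_p = −1`), the integral
cyclotomic PRODUCT divisibility of S6b gives the JOINT `p`-adic BSD upper bound
`ord_p #Ш(E) + ord_p #Ш(E_d) ≤ ord_p #Ш_an(E) + ord_p #Ш_an(E_d)` (both `#Ш_an` have ONE rational value).  Intended proof: exactly
the proof of `X11b.missingUpperBoundAt_of_classX11a_of_multDivisibilityAt` (Greenberg–Stevens / Jones Euler characteristic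
at a non-split multiplicative prime: `ord_p f_E(0) = ord_p(#Ш(E)[p^∞] · ∏ c_ℓ · #Ẽ^{ns}(𝔽_p)[p^∞]² …)`, torsion-free by `Irr`,
`L_p(E, 𝟙) = (1 − a_p⁻¹) L(E,1)/Ω_E = 2L(E,1)/Ω_E`, GZK for `Sel = Ш` in analytic rank `0`), run ONCE for each curve but
fed by a single product identity `ι(g) = ϖϖ_d L_p(E) L_p(E_d)` with `g ∈ (f_E)(f_{E_d})` (`char` principal:
`charIdeal_isPrincipal_holds`), so that only the SUM of the two sides is bounded.  The published inputs are K2's item 19949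
BY NAME (`KatoTwinFactsFiveAn`, as for the door).  Why it might fail: none foreseen beyond bookkeeping (`p ≥ 5`; at `p = 3`
the Tamagawa/torsion lemmas used by the door are the `5 ≤ p` versions — see «cartan3»).
[cite: Jones1989, Thm. 3.1 / §5 (Λ-adic Euler characteristic at multiplicative primes)] [cite: GreenbergLNM1716, §4 Thm. 4.1 and Prop. 3.8]
[cite: SteinWuthrich2013, Thm. 6.1 (p. 20)] [cite: Kato2004Asterisque, §17.13 (pp. 279–280)] -/
theorem stub_jointUpper_of_cycProductDivisibility_five :
    Theses.ErratumRoadFive.KatoTwinFactsFiveAn →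
    ∀ (W : WeierstrassCurve ℚ) [W.IsElliptic] [W.IsGloballyMinimal] (p : ℕ) [Fact p.Prime]
      (K : Type) [Field K] [NumberField K]
      (Wd : WeierstrassCurve ℚ) [Wd.IsElliptic] [Wd.IsGloballyMinimal],
      ClassX11a W p → ClassX11a Wd p → 5 ≤ p →
      IsImaginaryQuadratic K → ((Ideal.span {(p : ℤ)}).primesOver (𝓞 K)).ncard = 2 →
      (∃ C : VariableChange ℚ, C • W.quadraticTwist (NumberField.discr K : ℚ) = Wd) →
      ¬ W.HasSplitMultiplicativeReductionAtPrime p →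
      (∀ {κ : ZpExtension ℚ p} {γ : Field.absoluteGaloisGroup ℚ} {N Nd : ℕ} [NeZero N] [NeZero Nd]
        {f : CuspForm (Gamma0 N) 2} {fd : CuspForm (Gamma0 Nd) 2},
        κ.IsCyclotomic → κ.IsTopGenerator γ → IsCyclotomicVariable p γ →
        IsNewformOf W f → IsNewformOf Wd fd →
        ∀ (D : W.SelmerDualData κ γ) (Dd : Wd.SelmerDualData κ γ) (ϖ ϖd : ℚ), ϖ ≠ 0 → ϖd ≠ 0 →
          (ϖ : ℝ) * W.realPeriodRat = plusPeriod f → (ϖd : ℝ) * Wd.realPeriodRat = plusPeriod fd →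
          ∀ (L Ld : PowerSeries ℚ_[p]), IsMultPAdicLFunctionOf f p (-1) L → IsMultPAdicLFunctionOf fd p (-1) Ld →
            D.IsTorsion ∧ Dd.IsTorsion ∧
              ∃ g ∈ D.charIdeal * Dd.charIdeal,
                iwasawaToPowerSeries p g = PowerSeries.C (((ϖ * ϖd : ℚ)) : ℚ_[p]) * (L * Ld)) →
      ∃ q qd : ℚ, shaAn W = (q : ℂ) ∧ shaAn Wd = (qd : ℂ) ∧
        ((padicValNat p W.shaOrder : ℤ) + (padicValNat p Wd.shaOrder : ℤ) ≤
          padicValRat p q + padicValRat p qd) := by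
  sorry

/-- **Composition of the split (real proof): S5 + S6a + S6b + S6c ⟹ rev-1 stub 6** («Cartan-definite datum ⇒ joint bound»),
the generator data being CHOSEN by the landed `exists_isTopGeneratorPair_canonical` (K1′ clause «γ₁ canonical» is free).
[cite: MazurTateTeitelbaum1986Invent, §I.13] [cite: SkinnerUrban2014, Cor. 3.8] -/
theorem jointUpper_of_parts (hpub : Theses.ErratumRoadFive.KatoTwinFactsFiveAn)
    (W : WeierstrassCurve ℚ) [W.IsElliptic] [W.IsGloballyMinimal] (p : ℕ) [Fact p.Prime]
    (K : Type) [Field K] [NumberField K]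
    (Wd : WeierstrassCurve ℚ) [Wd.IsElliptic] [Wd.IsGloballyMinimal]
    (hX : ClassX11a W p) (hns : ¬ Surj W p) (hp5 : 5 ≤ p)
    (hK : IsImaginaryQuadratic K) (hsp : ((Ideal.span {(p : ℤ)}).primesOver (𝓞 K)).ncard = 2)
    (hWd : ∃ C : VariableChange ℚ, C • W.quadraticTwist (NumberField.discr K : ℚ) = Wd)
    (hred : ¬ (W.baseChange K).HasIrreducibleModPGaloisRep p)
    (hnsp : ¬ W.HasSplitMultiplicativeReductionAtPrime p) (hXd : ClassX11a Wd p) :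
    ∃ q qd : ℚ, shaAn W = (q : ℂ) ∧ shaAn Wd = (qd : ℂ) ∧
      ((padicValNat p W.shaOrder : ℤ) + (padicValNat p Wd.shaOrder : ℤ) ≤
        padicValRat p q + padicValRat p qd) := by
  have hp2 : p ≠ 2 := hX.2.1
  obtain ⟨κ₁, κ₂, γ₁, γ₂, hpair, hcyc, hanti, hcan⟩ :=
    Theorems.SignedBaseChangeCanonicalGeneratorPair.exists_isTopGeneratorPair_canonical (K := K) (p := p) hK hp2
  haveI : Fact (ZpExtension.IsTopGeneratorPair κ₁ κ₂ γ₁ γ₂) := ⟨hpair⟩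
  have h5 := stub_muOrd_eq_zero_of_reducible W p K κ₁ κ₂ γ₁ γ₂ hp2 hK hsp hX.2.2.1 hX.2.2.2.1 hred hnsp
  have h6a := stub_twoVarOrdDivisibility_cartanFive W p K Wd κ₁ κ₂ γ₁ γ₂ hX hns hp5 hK hsp hWd hred hnsp hcyc
    hanti hcan
  exact stub_jointUpper_of_cycProductDivisibility_five hpub W p K Wd hX hXd hp5 hK hsp hWd hnsp
    (stub_cycProductDivisibility_of_muOrd_cartanFive W p K Wd κ₁ κ₂ γ₁ γ₂ hX hns hp5 hK hsp hWd hred hnsp hcyc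
      hanti hcan h5 h6a)

/-! ## S7′ — the μ-road's input off the (now ARITHMETIC) Cartan-definite locus -/

/-- **stub S7′ (rev-2 price P1: arithmetic locus; the μ-road's open input RESTRICTED to the complement of the
Cartan-definite sub-locus)**: `Theorems.X11aNonSurjMuAnHardFive` (the unit-coefficient certificate of `ϖ·L_p(E)` on the hard
sub-locus) asked ONLY at pairs that are split multiplicative at `p`, or admit NO imaginary quadratic `K` with `p` split over
which `ρ̄` is reducible and whose twist `E^K` (minimal model `Wd`) lies in class X11a (= has analytic rank `0`).  Images `5S4`
(irreducible over every quadratic field), real-Cartan `5Ns/7Ns` pairs and pairs whose Cartan twin has positive rank live here.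
Strictly weaker than the line of record's `stub_muAnHardFive` (two extra hypotheses); class-wide still an instance of Greenberg's
Conj. 1.11 on its locus — declared, no prover (critic P5).
[cite: GreenbergLNM1716, Conj. 1.11 (p. 62) and Prop. 5.10] [cite: Kato2004Asterisque, §17.13 (pp. 279–280)] -/
theorem stub_muAnHard_offCartanFive :
    ∀ (W : WeierstrassCurve ℚ) [W.IsElliptic] [W.IsGloballyMinimal] (p : ℕ) [Fact p.Prime],
      ClassX11a W p → ¬ Surj W p → 5 ≤ p →
      (W.HasSplitMultiplicativeReductionAtPrime p ∨
        ∀ t : ℚ, W.entireLFunction 1 / (W.realPeriodRat : ℂ) = (t : ℂ) → padicValRat p t ≠ 0) →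
      (¬ W.HasSplitMultiplicativeReductionAtPrime p →
        ∀ (K : Type) [Field K] [NumberField K]
          (Wd : WeierstrassCurve ℚ) [Wd.IsElliptic] [Wd.IsGloballyMinimal],
          IsImaginaryQuadratic K → ((Ideal.span {(p : ℤ)}).primesOver (𝓞 K)).ncard = 2 →
          (∃ C : VariableChange ℚ, C • W.quadraticTwist (NumberField.discr K : ℚ) = Wd) →
          ¬ (W.baseChange K).HasIrreducibleModPGaloisRep p → ClassX11a Wd p → False) →
      ∀ {N : ℕ} [NeZero N] (f : CuspForm (Gamma0 N) 2), IsNewformOf W f →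
        ∀ (ϖ : ℚ), (ϖ : ℝ) * W.realPeriodRat = plusPeriod f →
        ∀ (a : ℚ_[p]) (L : PowerSeries ℚ_[p]),
          (W.HasSplitMultiplicativeReductionAtPrime p → a = 1) →
          (¬ W.HasSplitMultiplicativeReductionAtPrime p → a = -1) →
          IsMultPAdicLFunctionOf f p a L →
          ∃ n : ℕ, ‖PowerSeries.coeff n (PowerSeries.C ((ϖ : ℚ) : ℚ_[p]) * L)‖ = 1 := by
  sorry

/-! ## The crux BY NAME -/

/-- **Composition (the CARTAN ROAD rev 2; real proof, every stub applied BY NAME)**: split at `p` ⟹ S7′ (first disjunct) ⟹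
`multDivisibilityAt_of_katoFacts_of_muAn` ⟹ the door; non-split with unit value ⟹ the landed
`Theorems.x11a_missingUpperBoundAt_of_not_surj_of_nonsplit_of_unit_value`; non-split, non-unit value, WITH an (arithmetic)
Cartan-definite datum `(K, Wd)` ⟹ `jointUpper_of_parts` (S5, S6a, S6b, S6c, S3) gives the joint bound and the route's crux
19064 BY NAME (`stub_x11aLowerHalf` at `(Wd, p)`) subtracts the twin; WITHOUT such a datum ⟹ S7′ (second clause) ⟹ the door.
No `sorry` here. [cite: Kato2004Asterisque, §17.13 (pp. 279–280)] [cite: OukhabaViguie2016, Thm. 1.2 (arXiv:1311.3565 p. 2)] -/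
theorem UpperNonSurjFive_of_cartan : Theses.PrintX11a.UpperNonSurjFive := by
  have hpub : Theses.ErratumRoadFive.KatoTwinFactsFiveAn := stub_pubFactsAn
  obtain ⟨-, -, -, hGZK, hmod, -, hpar, -, -, -, -, hJs, hJn, hGS, -, -, hne, h12, hnsI, hspI, h15, h18,
    hfine⟩ := stub_pubFactsAn
  intro W _ _ p _ hX hns hp5
  have hp2 : p ≠ 2 := hX.2.1
  by_cases hsplit : W.HasSplitMultiplicativeReductionAtPrime p
  · exact missingUpperBoundAt_of_classX11a_of_multDivisibilityAt hJs hJn hGZK hmod hpar W p (hGS W p) hX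
      (multDivisibilityAt_of_katoFacts_of_muAn hne h12 hnsI hspI h15 h18 hfine W p hp2 hX.2.2.1
        hX.2.2.2.1 hns (stub_muAnHard_offCartanFive W p hX hns hp5 (Or.inl hsplit)
          (fun h => (h hsplit).elim)))
  · by_cases hunit : ∃ t : ℚ, W.entireLFunction 1 / (W.realPeriodRat : ℂ) = (t : ℂ) ∧ padicValRat p t = 0
    · obtain ⟨t, ht, hu⟩ := hunit
      exact Theorems.x11a_missingUpperBoundAt_of_not_surj_of_nonsplit_of_unit_value hJs hJn hGZK hmod
        hpar hne h12 hnsI hspI h15 h18 hfine W p (hGS W p) hX hns hsplit t ht hu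
    · have hhard : ∀ t : ℚ, W.entireLFunction 1 / (W.realPeriodRat : ℂ) = (t : ℂ) →
          padicValRat p t ≠ 0 := fun t ht hu => hunit ⟨t, ht, hu⟩
      by_cases hcart : ∃ (K : Type) (_ : Field K) (_ : NumberField K) (Wd : WeierstrassCurve ℚ)
          (_ : Wd.IsElliptic) (_ : Wd.IsGloballyMinimal),
          IsImaginaryQuadratic K ∧ ((Ideal.span {(p : ℤ)}).primesOver (𝓞 K)).ncard = 2 ∧
            (∃ C : VariableChange ℚ, C • W.quadraticTwist (NumberField.discr K : ℚ) = Wd) ∧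
            ¬ (W.baseChange K).HasIrreducibleModPGaloisRep p ∧ ClassX11a Wd p
      · obtain ⟨K, _, _, Wd, _, _, hK, hsp, hWd, hred, hXd⟩ := hcart
        obtain ⟨q, qd, hq, hqd, hj⟩ := jointUpper_of_parts hpub W p K Wd hX hns hp5 hK hsp hWd hred hsplit hXd
        obtain ⟨q', hq', hl⟩ := stub_x11aLowerHalf Wd p hXd
        have hqq : q' = qd := by exact_mod_cast hq'.symm.trans hqd
        subst hqq
        exact ⟨q, hq, by linarith⟩
      · have hoff : ∀ (K : Type) [Field K] [NumberField K]
            (Wd : WeierstrassCurve ℚ) [Wd.IsElliptic] [Wd.IsGloballyMinimal],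
            IsImaginaryQuadratic K → ((Ideal.span {(p : ℤ)}).primesOver (𝓞 K)).ncard = 2 →
            (∃ C : VariableChange ℚ, C • W.quadraticTwist (NumberField.discr K : ℚ) = Wd) →
            ¬ (W.baseChange K).HasIrreducibleModPGaloisRep p → ClassX11a Wd p → False := by
          intro K _ _ Wd _ _ hK hsp hWd hred hXd
          exact hcart ⟨K, inferInstance, inferInstance, Wd, inferInstance, inferInstance, hK, hsp, hWd, hred, hXd⟩
        exact missingUpperBoundAt_of_classX11a_of_multDivisibilityAt hJs hJn hGZK hmod hpar W p (hGS W p)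
          hX (multDivisibilityAt_of_katoFacts_of_muAn hne h12 hnsI hspI h15 h18 hfine W p hp2 hX.2.2.1
            hX.2.2.2.1 hns (stub_muAnHard_offCartanFive W p hX hns hp5 (Or.inr hhard) (fun _ => hoff)))

end Summit.BirchSwinnertonDyer.BirchSwinnertonDyer.Cruxes.UpperNonSurjFive.Cartan

end
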